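/-
Copyright: the b2b-balaban T⁴-continuum CRUX team, row NE7b OWNER lineage `t4-ne7b-p1` (gen 128). Project licence.
-/
import Summits.QuantumFields.BalabanUV.T4Continuum.Spine.NE7b.SupTorusScaleSizes
import Summits.QuantumFields.BalabanUV.T4Continuum.Spine.NE7b.SupLargeFieldCellsRare

/-!
# THE REGULATED POLYMER GAS AND THE PEIERLS BRICK ON THE TORUS, AT EVERY SCALE: at EVERY field `φ` of the road's class on the fine torus
# `(ℤ∕(n+1)s)^d` (`−λ ≤ u′(φ_x) ≤ Λ`, `λ < min(2,a)`), with (279)'s block chart `P` and (274)'s linearised form `H_φ`, the scale-`N` chart field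
# `N(0, c·C_N(cM_z))` of (281)'s decomposition (`c = 4∕((4d(n+1)² + a + Λ)((n+1)^d + 1))`, `K_N = c·π⁴∕(4·4^N·(c(min(2,a)−λ))²)`) carries, for
# ANY disjoint chart cells of `≤ v` indices, ANY symmetric adjacency with `≤ Δ` neighbours and ANY cell factors regulated at strength `κ` with
# `κK_N ≤ θ < 1`: the extensive bound `‖log Z(C)‖ ≤ #C(Δ+1)2e·εA_N^v` under `e·εA_N^v·(Δ+1)² ≤ 1∕2`, and the Peierls estimate
# `P(∀ p ∈ L, Ψ² ≤ Σ_{cell p}ω²) ≤ (e^{−½κΨ²}A_N^v)^{#L}`, `A_N = (1−θ)^{−κK_N∕(2θ)}` — the torus instances of (291)∕(294)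
# (row NE7b, node U5c; one `obtain` on (281) + (291)∕(294) BY NAME; [folklore])

Cell `pub-balaban`, sub-cell `t4`, spine estimate NE7b (`T4WeightBudget.RelWeightBound`; the cell's OWN estimate — NOT PRINTED in
[Bałaban 1983–89], NOT PROVED).  Crux-route work under `Spine/NE7b/` by the row OWNER (`t4-ne7b-p1` gen 128, file (298)) under FREEZE
(0)'s crux-prover clause, on § [NE7bP1-G127-HANDOFF] NEXT (3)(b)∕(d); NOTHING of Bałaban's is named as a Lean object, valued or asserted; no
`T4Continuum/Support` leaf typed; no `def`, no notation; zero `sorry`.  Imports (BY NAME): the OWNER's (286) `…SupTorusScaleSizes` (through it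
(281) `torus_fibre_covariance_frd`, `torus_form_blockCeiling`), (291) `…SupFibreScaleRegulatedGas` (`scale_regulated_norm_pertLogZ_le`,
`scale_regulated_norm_cellActivity_le`), (294) `…SupLargeFieldCellsRare` (`scale_measureReal_largeCells_le`).

WHY (located).  (291)∕(294) are stated at TEA's level ((273)'s data `H, P, M_z`); the road's objects live on the torus: (281) produces, at
every field of the class, the block chart and the linearised form with exactly (273)'s hypotheses (floor `min(2,a) − λ`, ceiling
`4d(n+1)² + a + Λ`, chart bounds `1` and `(n+1)^d + 1`).  This file is the `obtain` that reads (291)∕(294) there — the pattern of (286).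

WHAT IS PROVED ([folklore]):
* §1 THE END **`torus_scale_regulated_gas`**: `∃ P H_φ` with (279)'s chart clauses and (274)'s form clauses, and for every `M_z` with the
  displayed entries and every scale `N`: (a) the activity bound `‖M(K)‖ ≤ (εA_N^v)^{#K}` for regulated chart-cell factors; (b)
  `‖log Z(C)‖ ≤ #C(Δ+1)2e·εA_N^v` under `e·εA_N^v·(Δ+1)² ≤ 1∕2`; (c) the Peierls brick `P(∀ p ∈ L, Ψ² ≤ Σ_{cell p}ω²) ≤ (e^{−½κΨ²}A_N^v)^{#L}`
  — for all cell data, adjacencies, factors and thresholds as quantified; §2 toy.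

HONEST (what this is NOT).  One `obtain`; chart coordinates (the road's factors as functions of `Pz` are cell-measurable and regulated in `z` by
(279)'s block-locality and the chart ceiling — the consumer's reading); one scale at a time; scalar skeleton ((A3), NC-NE7b-α UNRULED);
nothing of Bałaban's asserted.  BY-NAME EFFECT ON THE WALL: NONE.  NE7b NOT PRINTED ∕ NOT PROVED; spine PROVED 0∕9; rung (B)+1 — the programme's
measures remain FINITE-torus statements; NOT the mass gap, NOT Clay.  HONEST DEPENDENCY: continuum YM on T⁴ ⇐ BetaPertH ∧ nine spine estimates
(0∕9 proved); BetaPertH ⇐ (D1) ∧ (D4) ∧ CAP+tail; G-an2-4 gates asym, D1 and NE2∕3∕4.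
-/

set_option autoImplicit false

noncomputable section

namespace Summit.QuantumFields.BalabanUV.T4Continuum.NE7b.SupTorusScaleRegulatedGas

open MeasureTheory ProbabilityTheory Matrix Real
open scoped ENNReal
open Literature.MathematicalPhysics.QuantumFieldTheory.Balaban1983to89
open Literature.Analysis.Matrix (frdPiece)
open Literature.Probability.LatticeModels (cellActivity pertLogZ)
open B6QGQLower276 (X e blk B side AX)
open B5Hk103ScalarZd (nbhd)
open Beta (Site siteOf windowMap)
open SupTorusFibreFiniteRangeDecomposition (torus_fibre_covariance_frd torus_form_blockCeiling)
open SupFibreScaleRegulatedGas (scale_regulated_norm_pertLogZ_le scale_regulated_norm_cellActivity_le)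
open SupLargeFieldCellsRare (scale_measureReal_largeCells_le)

variable {d : ℕ} (n : ℕ) (a : ℝ) (s : ℕ) [NeZero s]
  {Dop Aop : lp (fun _ : X d => ℝ) ∞ →L[ℝ] lp (fun _ : X d => ℝ) ∞}
  (hA : ∀ (f : lp (fun _ : X d => ℝ) ∞) (p : X d), Aop f p = ∑ r ∈ nbhd n p, AX n a p r * f r)
  (hD : ∀ (f : lp (fun _ : X d => ℝ) ∞) (y : X d), Dop f y = (((n : ℝ) + 1) ^ d)⁻¹ * ∑ p ∈ B n y, f p)
  {Ef : (Site d ((n + 1) * s) → ℝ) →L[ℝ] lp (fun _ : X d => ℝ) ∞}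
  (hEf : ∀ (g : Site d ((n + 1) * s) → ℝ) (q : X d), Ef g q = g (siteOf d ((n + 1) * s) q))
  {Rf : lp (fun _ : X d => ℝ) ∞ →L[ℝ] (Site d ((n + 1) * s) → ℝ)}
  (hRf : ∀ (h : lp (fun _ : X d => ℝ) ∞) (x : Site d ((n + 1) * s)), Rf h x = h (windowMap d ((n + 1) * s) x))
  {Rc : lp (fun _ : X d => ℝ) ∞ →L[ℝ] (Site d s → ℝ)}
  (hRc : ∀ (h : lp (fun _ : X d => ℝ) ∞) (x : Site d s), Rc h x = h (windowMap d s x))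

/-! ## §1. THE END -/

include hA hD hEf hRf hRc in
/-- **THE END — THE REGULATED POLYMER GAS AND THE PEIERLS BRICK ON THE TORUS, AT EVERY SCALE.**  At every field `φ` of the class (`a > 0`,
`0 ≤ Λ`, `−λ ≤ u′(φ_x) ≤ Λ`, `λ < min(2,a)`) there are (279)'s block chart `P` and (274)'s linearised form `H_φ` such that for every `M_z` with
`M_z(j,k) = H_φ(Pe_j)(Pe_k)` and every scale `N` (with `c = 4∕((4d(n+1)²+a+Λ)((n+1)^d+1))`, `K_N = c·π⁴∕(4·4^N·(c(min(2,a)−λ)·1)²)`,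
`A_N = (1−θ)^{−κK_N∕(2θ)}`), under the scale-`N` chart law `N(0, c·C_N(cM_z))`:
(a) for ANY index type of cells, disjoint chart cells of `≤ v` indices, regulated factors `‖g_p(ω)‖ ≤ ε·e^{½κΣ_{j∈cell p}ω_j²}` (`0 ≤ ε`, `0 ≤ κ`,
`0 < θ < 1`, `κK_N ≤ θ`) and every finite `K`: `‖∫∏_{p∈K}g_p‖ ≤ (εA_N^v)^{#K}`;
(b) with moreover a symmetric adjacency with `≤ Δ` neighbours and `e·εA_N^v·(Δ+1)² ≤ 1∕2`: `‖log Z(C)‖ ≤ #C·(Δ+1)·2e·εA_N^v` for every finite `C`;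
(c) for every finite family `L` of cells and every `Ψ`: `P(∀ p ∈ L, Ψ² ≤ Σ_{j∈cell p}ω_j²) ≤ (e^{−½κΨ²}·A_N^v)^{#L}`. [folklore] -/
theorem torus_scale_regulated_gas (ha : 0 < a) {u' : ℝ → ℝ} {lam Lam : ℝ} {φ : Site d ((n + 1) * s) → ℝ} (hLam : 0 ≤ Lam)
    (hu' : ∀ x, -lam ≤ u' (φ x)) (hu'Λ : ∀ x, u' (φ x) ≤ Lam) (hγ : lam < min 2 a) :
    ∃ (P : ((Site d s × {z : Fin d → Fin (n + 1) // z ≠ 0}) → ℝ) →L[ℝ] (Site d ((n + 1) * s) → ℝ))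
      (Hφ : (Site d ((n + 1) * s) → ℝ) →L[ℝ] (Site d ((n + 1) * s) → ℝ) →L[ℝ] ℝ),
      (∀ ζ, ((Rc.comp Dop).comp Ef) (P ζ) = 0) ∧
      (∀ ζ, (1 : ℝ) * ∑ i, ζ i ^ 2 ≤ ∑ x, P ζ x ^ 2) ∧
      (∀ ζ, ∑ x, P ζ x ^ 2 ≤ (((n : ℝ) + 1) ^ d + 1) * ∑ i, ζ i ^ 2) ∧
      (∀ h : Site d ((n + 1) * s) → ℝ, ((Rc.comp Dop).comp Ef) h = 0 → ∃ ζ, P ζ = h) ∧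
      (∀ (j : Site d s × {z : Fin d → Fin (n + 1) // z ≠ 0}) (x : Site d ((n + 1) * s)),
        siteOf d s (blk n (windowMap d ((n + 1) * s) x)) ≠ j.1 → P (Pi.single j 1) x = 0) ∧
      (∀ h k, Hφ h k = ∑ x, (((Rf.comp Aop).comp Ef) h x + u' (φ x) * h x) * k x) ∧
      (∀ h k, Hφ h k = Hφ k h) ∧
      (∀ h, (min 2 a - lam) * ∑ x, h x ^ 2 ≤ Hφ h h) ∧
      ∀ Mz : Matrix (Site d s × {z : Fin d → Fin (n + 1) // z ≠ 0}) (Site d s × {z : Fin d → Fin (n + 1) // z ≠ 0}) ℝ,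
        (∀ j k, Mz j k = Hφ (P (Pi.single j 1)) (P (Pi.single k 1))) → ∀ N : ℕ,
        -- (a) the activity bound for regulated chart-cell factors
        (∀ (V : Type) [DecidableEq V] (cell : V → Finset (Site d s × {z : Fin d → Fin (n + 1) // z ≠ 0}))
          (_ : ∀ p' q', p' ≠ q' → Disjoint (cell p') (cell q')) (v : ℕ) (_ : ∀ p', (cell p').card ≤ v)
          (g : V → EuclideanSpace ℝ (Site d s × {z : Fin d → Fin (n + 1) // z ≠ 0}) → ℂ) (ε κ θ : ℝ),
          0 ≤ ε → 0 ≤ κ → 0 < θ → θ < 1 → κ * (((4 / ((4 * d * ((n : ℝ) + 1) ^ 2 + a + Lam) * (((n : ℝ) + 1) ^ d + 1))) : ℝ) * (π ^ 4 / (4 * 4 ^ N * (((4 / ((4 * d * ((n : ℝ) + 1) ^ 2 + a + Lam) * (((n : ℝ) + 1) ^ d + 1))) : ℝ) * (min 2 a - lam) * 1) ^ 2))) ≤ θ →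
          (∀ p' ω, ‖g p' ω‖ ≤ ε * exp (κ * (∑ j ∈ cell p', ω j ^ 2) / 2)) →
          ∀ K : Finset V, ‖cellActivity (multivariateGaussian 0 (((4 / ((4 * d * ((n : ℝ) + 1) ^ 2 + a + Lam) * (((n : ℝ) + 1) ^ d + 1))) : ℝ) • frdPiece (((4 / ((4 * d * ((n : ℝ) + 1) ^ 2 + a + Lam) * (((n : ℝ) + 1) ^ d + 1))) : ℝ) • Mz) N)) g K‖ ≤ (ε * ((1 - θ) ^ (-(κ * (((4 / ((4 * d * ((n : ℝ) + 1) ^ 2 + a + Lam) * (((n : ℝ) + 1) ^ d + 1))) : ℝ) * (π ^ 4 / (4 * 4 ^ N * (((4 / ((4 * d * ((n : ℝ) + 1) ^ 2 + a + Lam) * (((n : ℝ) + 1) ^ d + 1))) : ℝ) * (min 2 a - lam) * 1) ^ 2))) / (2 * θ)))) ^ v) ^ K.card) ∧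
        -- (b) extensivity of `log Z`
        (∀ (V : Type) [DecidableEq V] (cell : V → Finset (Site d s × {z : Fin d → Fin (n + 1) // z ≠ 0}))
          (_ : ∀ p' q', p' ≠ q' → Disjoint (cell p') (cell q')) (v : ℕ) (_ : ∀ p', (cell p').card ≤ v)
          (R : V → V → Prop) [DecidableRel R] (_ : ∀ x y, R x y → R y x) (nbr : V → Finset V) (Δ : ℕ)
          (_ : ∀ x, (nbr x).card ≤ Δ) (_ : ∀ x y, R x y → y ∈ nbr x)
          (g : V → EuclideanSpace ℝ (Site d s × {z : Fin d → Fin (n + 1) // z ≠ 0}) → ℂ) (ε κ θ : ℝ),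
          0 ≤ ε → 0 ≤ κ → 0 < θ → θ < 1 → κ * (((4 / ((4 * d * ((n : ℝ) + 1) ^ 2 + a + Lam) * (((n : ℝ) + 1) ^ d + 1))) : ℝ) * (π ^ 4 / (4 * 4 ^ N * (((4 / ((4 * d * ((n : ℝ) + 1) ^ 2 + a + Lam) * (((n : ℝ) + 1) ^ d + 1))) : ℝ) * (min 2 a - lam) * 1) ^ 2))) ≤ θ →
          (∀ p' ω, ‖g p' ω‖ ≤ ε * exp (κ * (∑ j ∈ cell p', ω j ^ 2) / 2)) →
          Real.exp 1 * (ε * ((1 - θ) ^ (-(κ * (((4 / ((4 * d * ((n : ℝ) + 1) ^ 2 + a + Lam) * (((n : ℝ) + 1) ^ d + 1))) : ℝ) * (π ^ 4 / (4 * 4 ^ N * (((4 / ((4 * d * ((n : ℝ) + 1) ^ 2 + a + Lam) * (((n : ℝ) + 1) ^ d + 1))) : ℝ) * (min 2 a - lam) * 1) ^ 2))) / (2 * θ)))) ^ v) * ((Δ : ℝ) + 1) ^ 2 ≤ 1 / 2 →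
          ∀ C : Finset V, ‖pertLogZ (multivariateGaussian 0 (((4 / ((4 * d * ((n : ℝ) + 1) ^ 2 + a + Lam) * (((n : ℝ) + 1) ^ d + 1))) : ℝ) • frdPiece (((4 / ((4 * d * ((n : ℝ) + 1) ^ 2 + a + Lam) * (((n : ℝ) + 1) ^ d + 1))) : ℝ) • Mz) N)) g R C‖ ≤
            C.card * ((Δ : ℝ) + 1) * (2 * (Real.exp 1 * (ε * ((1 - θ) ^ (-(κ * (((4 / ((4 * d * ((n : ℝ) + 1) ^ 2 + a + Lam) * (((n : ℝ) + 1) ^ d + 1))) : ℝ) * (π ^ 4 / (4 * 4 ^ N * (((4 / ((4 * d * ((n : ℝ) + 1) ^ 2 + a + Lam) * (((n : ℝ) + 1) ^ d + 1))) : ℝ) * (min 2 a - lam) * 1) ^ 2))) / (2 * θ)))) ^ v)))) ∧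
        -- (c) the Peierls brick
        (∀ (V : Type) [DecidableEq V] (cell : V → Finset (Site d s × {z : Fin d → Fin (n + 1) // z ≠ 0}))
          (_ : ∀ p' q', p' ≠ q' → Disjoint (cell p') (cell q')) (v : ℕ) (_ : ∀ p', (cell p').card ≤ v) (κ θ : ℝ),
          0 ≤ κ → 0 < θ → θ < 1 → κ * (((4 / ((4 * d * ((n : ℝ) + 1) ^ 2 + a + Lam) * (((n : ℝ) + 1) ^ d + 1))) : ℝ) * (π ^ 4 / (4 * 4 ^ N * (((4 / ((4 * d * ((n : ℝ) + 1) ^ 2 + a + Lam) * (((n : ℝ) + 1) ^ d + 1))) : ℝ) * (min 2 a - lam) * 1) ^ 2))) ≤ θ →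
          ∀ (L : Finset V) (Ψ : ℝ),
            (multivariateGaussian 0 (((4 / ((4 * d * ((n : ℝ) + 1) ^ 2 + a + Lam) * (((n : ℝ) + 1) ^ d + 1))) : ℝ) • frdPiece (((4 / ((4 * d * ((n : ℝ) + 1) ^ 2 + a + Lam) * (((n : ℝ) + 1) ^ d + 1))) : ℝ) • Mz) N)).real
                {ω : EuclideanSpace ℝ (Site d s × {z : Fin d → Fin (n + 1) // z ≠ 0}) | ∀ p' ∈ L, Ψ ^ 2 ≤ ∑ j ∈ cell p', ω j ^ 2} ≤
              (exp (-(κ * Ψ ^ 2 / 2)) * ((1 - θ) ^ (-(κ * (((4 / ((4 * d * ((n : ℝ) + 1) ^ 2 + a + Lam) * (((n : ℝ) + 1) ^ d + 1))) : ℝ) * (π ^ 4 / (4 * 4 ^ N * (((4 / ((4 * d * ((n : ℝ) + 1) ^ 2 + a + Lam) * (((n : ℝ) + 1) ^ d + 1))) : ℝ) * (min 2 a - lam) * 1) ^ 2))) / (2 * θ)))) ^ v) ^ L.card) := by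
  classical
  obtain ⟨P, Hφ, hQP, hPlow, hPup, hPsurj, hPloc, hH, hHsym, hfl, -⟩ :=
    torus_fibre_covariance_frd n a s hA hD hEf hRf hRc ha hLam hu' hu'Λ hγ
  have hm : 0 < min 2 a - lam := sub_pos.2 hγ
  have hΛH : 0 < 4 * d * ((n : ℝ) + 1) ^ 2 + a + Lam := by positivity
  have hq : (0 : ℝ) < ((n : ℝ) + 1) ^ d + 1 := by positivity
  have hceil : ∀ h, Hφ h h ≤ (4 * d * ((n : ℝ) + 1) ^ 2 + a + Lam) * ∑ x, h x ^ 2 := fun h => by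
    rw [hH]; exact torus_form_blockCeiling n a s hA hEf hRf ha.le hu'Λ h
  refine ⟨P, Hφ, hQP, hPlow, hPup, hPsurj, hPloc, hH, hHsym, hfl, fun Mz hMz N => ⟨?_, ?_, ?_⟩⟩
  · intro V _ cell hdisj v hv g ε κ θ hε hκ hθ0 hθ1 hκθ hreg K
    exact scale_regulated_norm_cellActivity_le P hHsym hfl hm hceil hΛH hPlow one_pos hPup hq Mz hMz N cell hdisj hv hε hκ hθ0 hθ1 hκθ
      hreg K
  · intro V _ cell hdisj v hv R _ hRsymm nbr Δ hΔ hnbr g ε κ θ hε hκ hθ0 hθ1 hκθ hreg hsmall C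
    exact scale_regulated_norm_pertLogZ_le P hHsym hfl hm hceil hΛH hPlow one_pos hPup hq Mz hMz N cell hdisj hv hRsymm hΔ hnbr hε hκ
      hθ0 hθ1 hκθ hreg hsmall C
  · intro V _ cell hdisj v hv κ θ hκ hθ0 hθ1 hκθ L Ψ
    exact scale_measureReal_largeCells_le P hHsym hfl hm hceil hΛH hPlow one_pos hPup hq Mz hMz N cell hdisj hv hκ hθ0 hθ1 hκθ L Ψ

/-! ## §2. Toy -/

/-- Toy: the scale regulator cost `A_N = (1−θ)^{−κK_N∕(2θ)}` is `≥ 1` for `0 < θ < 1` and `κ, K_N ≥ 0` ((289)'s `one_le_regulatorCost`). -/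
example (κ K θ : ℝ) (hκ : 0 ≤ κ) (hK : 0 ≤ K) (hθ0 : 0 < θ) (hθ1 : θ < 1) : 1 ≤ (1 - θ) ^ (-(κ * K / (2 * θ))) :=
  SupRegulatedActivityBound.one_le_regulatorCost (mul_nonneg hκ hK) hθ0 hθ1

end Summit.QuantumFields.BalabanUV.T4Continuum.NE7b.SupTorusScaleRegulatedGas
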